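import Summits.Ventures.PercRepro.RankLevelSetCoreSixColoopFreeFlatCap

/-!
# PercRepro — THE UNION LEMMA WITH THE COLOOP-FREE CAP: `|UG| ≤ q + (j+1)d − jν₁ − j − 1` (p8 g10, S3)

`proofs/SUBCLAIM-S3-p8.md` §3x. The union lemma of `sq27di` (`ncard_biUnion_le_of_heavy`, RankLevelSetDepCountHeavyA) closes
with the nullity cap `|⋃𝓕| ≤ r(⋃𝓕) + d`; on a COLOOP-FREE core the union of heavy flats is not spanning, so the coloop-free
cap `|⋃𝓕| + 1 ≤ r(⋃𝓕) + d` (RankLevelSetCoreSixColoopFreeFlatCap) applies and the same invariant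
`(j + 1)·r(⋃𝓕) + j·ν₁ ≤ ρ + j·|⋃𝓕|` gives `|⋃𝓕| ≤ ρ + (j + 1)·d − j·ν₁ − j − 1` (`ncard_biUnion_le_of_heavy_cf`), hence
`|UG M q ν₁| ≤ q + (j + 1)d − jν₁ − j − 1` (`ncard_UG_le_cf`) and `|UH M q ν₁| ≤ (q − 1) + (j' + 1)d − j'ν₁ − j' − 1`
(`ncard_UH_le_cf`): the heavy windows of the cells `(24, 9)` and `(24, 10)` shrink by `2^{j+1}`. Axioms: standard.
-/

open scoped Matroid

namespace PercRepro

namespace Matroid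

open Set Finset

variable {α : Type} {M : _root_.Matroid α}

/-- **The union of a heavy family on a coloop-free core**: `|⋃𝓕| ≤ ρ + (j + 1)·d − j·ν₁ − j − 1` when the union is not
spanning (`ρ + j·d < p + j·ν₁`). -/
theorem ncard_biUnion_le_of_heavy_cf [M.Finite] {ρ ν₁ j p d : ℕ}
    (hcf : ∀ e ∈ M.E, ¬ M.IsColoop e) (hR : M.eRank = (p : ℕ∞)) (hn : M.E.ncard = p + d)
    (hρ : ρ + j * d < p + j * ν₁)
    (𝓕 : Finset (Set α))
    (hFE : ∀ F ∈ 𝓕, F ⊆ M.E) (hrk : ∀ F ∈ 𝓕, M.eRk F = ρ) (hν : ∀ F ∈ 𝓕, ρ + ν₁ ≤ F.ncard)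
    (hinter : ∀ F ∈ 𝓕, ∀ F' ∈ 𝓕, F ≠ F' → ((ρ - j : ℕ) : ℕ∞) ≤ M.eRk (F ∩ F'))
    (hsub : ∀ F ∈ 𝓕, ∀ S ⊆ F, S ≠ F → ∀ r : ℕ, M.eRk S = r → S.ncard + ρ + 1 ≤ F.ncard + r) :
    (⋃ F ∈ 𝓕, F).ncard ≤ ρ + (j + 1) * d - j * ν₁ - j - 1 := by
  classical
  have hd : M.E.encard = M.eRank + d := by
    rw [hR, ← M.ground_finite.cast_ncard_eq, hn]
    push_cast; ring
  rcases 𝓕.eq_empty_or_nonempty with h | hne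
  · rw [h]
    simp only [Finset.notMem_empty, Set.iUnion_of_empty, Set.iUnion_empty, Set.ncard_empty]
    exact Nat.zero_le _
  · have hUE : (⋃ F ∈ 𝓕, F) ⊆ M.E := by
      intro x hx
      rw [Set.mem_iUnion₂] at hx
      obtain ⟨G, hG, hxG⟩ := hx
      exact hFE G hG hxG
    obtain ⟨r, hr⟩ := exists_eRk_eq_nat (M := M) hUE
    have hinv := union_bound 𝓕 hne hFE hrk hν hinter hsub hr
    have hcap : (⋃ F ∈ 𝓕, F).ncard ≤ r + d := ncard_le_add_of_eRk_eq hUE hd hr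
    have h1 : j * (⋃ F ∈ 𝓕, F).ncard ≤ j * r + j * d := by
      rw [← Nat.mul_add]
      exact Nat.mul_le_mul_left _ hcap
    have h2 : r + j * ν₁ ≤ ρ + j * d := by linarith
    have hrp : r < p := by omega
    have hcf' := ThmN.ncard_add_one_le_eRk_add_of_coloopFree M hcf hR hn hUE hr hrp
    have h3 : j * (⋃ F ∈ 𝓕, F).ncard + j ≤ j * r + j * d := by
      have := Nat.mul_le_mul_left j hcf'
      rw [Nat.mul_add, Nat.mul_add, Nat.mul_one] at this
      omega
    have h2' : r + j * ν₁ + j ≤ ρ + j * d := by linarith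
    have e2 : (j + 1) * d = j * d + d := by ring
    omega

/-- **`|UG| ≤ q + (j + 1)·d − j·ν₁ − j − 1` on a coloop-free core.** -/
theorem ncard_UG_le_cf [M.Finite] {q ν₁ j c cj p d : ℕ} (hq : 2 ≤ q)
    (hcf : ∀ e ∈ M.E, ¬ M.IsColoop e) (hR : M.eRank = (p : ℕ∞)) (hn : M.E.ncard = p + d)
    (hρ : q + j * d < p + j * ν₁)
    (hc : ∀ X ⊆ M.E, M.eRk X ≤ ((q - 2 : ℕ) : ℕ∞) → (X.ncard : ℕ∞) ≤ M.eRk X + c) (hν : c + 1 ≤ ν₁)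
    (hcj : ∀ X ⊆ M.E, M.eRk X ≤ ((q - j - 1 : ℕ) : ℕ∞) → (X.ncard : ℕ∞) ≤ M.eRk X + cj)
    (hνj : d + cj + 1 ≤ 2 * ν₁) :
    (UG M q ν₁).ncard ≤ q + (j + 1) * d - j * ν₁ - j - 1 := by
  have hd : M.E.encard = M.eRank + d := by
    rw [hR, ← M.ground_finite.cast_ncard_eq, hn]
    push_cast; ring
  unfold UG
  refine ncard_biUnion_le_of_heavy_cf hcf hR hn hρ (goodFlats M q ν₁) (fun F hF => (mem_goodFlats.1 hF).1)
    (fun F hF => (mem_goodFlats.1 hF).2.2.1) (fun F hF => (mem_goodFlats.1 hF).2.2.2.1) ?_ ?_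
  · intro F hF F' hF' _
    obtain ⟨hFE, -, hrF, hνF, -⟩ := mem_goodFlats.1 hF
    obtain ⟨hF'E, -, hrF', hνF', -⟩ := mem_goodFlats.1 hF'
    exact eRk_inter_ge_of_heavy hd hcj hνj hFE hF'E hrF hrF' hνF hνF'
  · intro F hF S hS hSF r hr
    obtain ⟨hFE, hFc, hrF, hνF, hgood⟩ := mem_goodFlats.1 hF
    exact ncard_add_le_of_ssubset_good hq hc hν hFE hFc hrF hνF
      (fun H hHE hHc hrH hνH x => hgood H ⟨hHE, hHc, hrH, hνH⟩ x) hS hSF hr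

/-- **`|UH| ≤ (q − 1) + (j' + 1)·d − j'·ν₁ − j' − 1` on a coloop-free core.** -/
theorem ncard_UH_le_cf [M.Finite] {q ν₁ j' c cj' p d : ℕ} (hq : 2 ≤ q)
    (hcf : ∀ e ∈ M.E, ¬ M.IsColoop e) (hR : M.eRank = (p : ℕ∞)) (hn : M.E.ncard = p + d)
    (hρ : (q - 1) + j' * d < p + j' * ν₁)
    (hc : ∀ X ⊆ M.E, M.eRk X ≤ ((q - 2 : ℕ) : ℕ∞) → (X.ncard : ℕ∞) ≤ M.eRk X + c) (hν : c + 1 ≤ ν₁)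
    (hcj' : ∀ X ⊆ M.E, M.eRk X ≤ ((q - 1 - j' - 1 : ℕ) : ℕ∞) → (X.ncard : ℕ∞) ≤ M.eRk X + cj')
    (hνj' : d + cj' + 1 ≤ 2 * ν₁) :
    (UH M q ν₁).ncard ≤ (q - 1) + (j' + 1) * d - j' * ν₁ - j' - 1 := by
  have hd : M.E.encard = M.eRank + d := by
    rw [hR, ← M.ground_finite.cast_ncard_eq, hn]
    push_cast; ring
  unfold UH
  refine ncard_biUnion_le_of_heavy_cf (ρ := q - 1) hcf hR hn hρ (hFlats M q ν₁) (fun H hH => (mem_hFlats.1 hH).1)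
    (fun H hH => (mem_hFlats.1 hH).2.2.1) (fun H hH => (mem_hFlats.1 hH).2.2.2) ?_ ?_
  · intro H hH H' hH' _
    obtain ⟨hHE, -, hrH, hνH⟩ := mem_hFlats.1 hH
    obtain ⟨hH'E, -, hrH', hνH'⟩ := mem_hFlats.1 hH'
    exact eRk_inter_ge_of_heavy hd hcj' hνj' hHE hH'E hrH hrH' hνH hνH'
  · intro H hH S hS hSH r hr
    obtain ⟨hHE, -, hrH, hνH⟩ := mem_hFlats.1 hH
    exact ncard_add_le_of_ssubset_hfam hq hc hν hHE hrH hνH hS hSH hr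

end Matroid

end PercRepro
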